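import Literature.Analysis.FluidPDE.FourierL2Trajectory
import Literature.Analysis.FluidPDE.FourierL2Duhamel
import Literature.Analysis.FluidPDE.FourierL2Sobolev
import Mathlib.Analysis.MeanInequalitiesPow
import HarnessLib

/-!
# One Duhamel step in the weighted-`L²` class: pointwise and integrated bounds

Sixth file of the weighted-`L²` Fourier-side construction of the local smooth solution of the
Navier–Stokes system with `H¹`-controlled lifespan (discharge of
`Literature.Analysis.FluidPDE.tao2011_fourier_local_existence`; Tao 2013, Thm. 5.4 (ii)+(iv)).
For two `L²`-continuous trajectories `p, q` (`FourierL2Trajectory`) the bilinear Duhamel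
integral at frequency `ξ`,

  `J(t, ξ) = ∫₀ᵗ e^{-c‖ξ‖²(t-s)} N(p s, q s)(ξ) ds`

(`N = FourierNS.nonlin`; the Picard map uses `J(v, v)`, differences of iterates use
`J(v - v', v) + J(v', v - v')`), is controlled through the scalar function

  `φ_ξ(s) = 4π (card ι)² ‖(M_p(s) ⋆ M_q(s))(ξ)‖`,  `M_p(s) = (∑ⱼ ‖p s ·j‖ : ℂ)` the real majorants,

which dominates `‖N(p s, q s)(ξ)‖ / ‖ξ‖` (`FourierL2Nonlin`, `lconv_majorant_eq_enorm_fconv`).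
This file combines the fixed-frequency time estimates of `FourierL2Duhamel` with the bilinear
Sobolev estimate of `FourierL2Sobolev`:

* pointwise in `ξ` (any dimension): `enorm_bilinDuhamel_sq_le` (sup: `‖J(t,ξ)‖² ≤ (2c)⁻¹ ∫φ_ξ²`),
  `enorm_bilinDuhamel_sq_le_low` (`‖J‖² ≤ ‖ξ‖²T ∫φ_ξ²`), `lintegral_enorm_bilinDuhamel_sq_le`
  (Schur: `c‖ξ‖⁴∫‖J‖² ≤ c⁻¹‖ξ‖² ∫φ_ξ²`), `exp_mul_weight_mul_enorm_bilinDuhamel_le` (the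
  `e^{-λt}(1+‖ξ‖)^k`-weighted envelope step with gain `1/(2√(cλ))`);
* integrated over `ξ ∈ ℝ³` (Tonelli + `eLpNorm_lconv_norm_weight_le`):
  `lintegral_sq_weight_phi_le` (`∫ρ² ∫φ² ≲ A₁(p)^{1/2}A₁(q)(T P₁(p))^{1/2} + …`, the Fourier form of
  Tao's `‖∇(uv)‖_{L²_tL²_x} ≲ T^{1/4}‖u‖_{X¹}‖v‖_{X¹}`, arXiv Lemma 23 (bilinear-2)) and
  `lintegral_fourth_weight_phi_le` (the `ρ⁴` level, linear in the `X²`-type quantities).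

All quantities are `ℝ≥0∞`-valued; no definitions are introduced (the recurring expressions are
spelled out), so that the file is a pure theorem file.

## References

* T. Tao, Anal. PDE 6 (2013) = arXiv:1108.1165, Lemma 2.1 = arXiv Lemma 23 (energy-duh2),
  (bilinear-2), and the proof of Thm. 5.1/5.4 (arXiv pp. 16, 18). [Tao2011]
-/

noncomputable section

open MeasureTheory Real Set Filter Function intervalIntegral
open scoped ENNReal NNReal
open _root_.Topology

namespace Literature.Analysis.FluidPDE.FourierNS

variable {ι : Type*} [Fintype ι] [DecidableEq ι]

/-! ### The nonlinearity of two `L²` fields dominated through the real majorants -/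

section Pointwise

variable {p q : ℝ → EuclideanSpace ℝ ι → ι → ℂ}

/-- **The nonlinearity of two fields with square-integrable components is dominated through the
real majorants**: `‖N(u, u')(ξ)‖ₑ ≤ ‖ξ‖ · 4π(card ι)² ‖(M ⋆ M')(ξ)‖ₑ`. [folklore] -/
theorem enorm_nonlin_le_majorantC {u u' : EuclideanSpace ℝ ι → ι → ℂ}
    (hu : AEStronglyMeasurable u volume) (hu' : AEStronglyMeasurable u' volume)
    (h2 : ∀ j, MemLp (u · j) 2 volume) (h2' : ∀ j, MemLp (u' · j) 2 volume)
    (ξ : EuclideanSpace ℝ ι) :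
    ‖nonlin u u' ξ‖ₑ ≤ ENNReal.ofReal ‖ξ‖ * (ENNReal.ofReal (4 * π) * (Fintype.card ι : ℝ≥0∞) ^ 2 *
      ‖fconv (fun η => ((∑ j, ‖u η j‖ : ℝ) : ℂ)) (fun η => ((∑ j, ‖u' η j‖ : ℝ) : ℂ)) ξ‖ₑ) := by
  -- sup norm from the components (`pi_norm_le_iff_of_nonneg`, through `toReal`)
  have hpi : ∀ {x : ι → ℂ} {b : ℝ≥0∞}, (∀ l, ‖x l‖ₑ ≤ b) → ‖x‖ₑ ≤ b := by
    intro x b h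
    rcases eq_or_ne b ⊤ with hb | hb
    · rw [hb]; exact le_top
    rw [← ofReal_norm, ← ENNReal.ofReal_toReal hb]
    refine ENNReal.ofReal_le_ofReal ((pi_norm_le_iff_of_nonneg ENNReal.toReal_nonneg).2 fun l => ?_)
    rw [← ENNReal.ofReal_le_ofReal_iff ENNReal.toReal_nonneg, ofReal_norm, ENNReal.ofReal_toReal hb]
    exact h l
  refine hpi fun l => ?_
  rw [← lconv_majorant_eq_enorm_fconv hu hu' h2 h2' ξ]
  calc ‖nonlin u u' ξ l‖ₑ ≤ _ := enorm_nonlin_apply_le u u' ξ l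
    _ = _ := by ring

/-! ### The bilinear Duhamel integral at a fixed frequency -/

variable {c T : ℝ}

omit [DecidableEq ι] in
/-- Joint measurability of `φ(s, ξ) = C ‖(M_p(s) ⋆ M_q(s))(ξ)‖ₑ` along `L²`-continuous
trajectories (it is `C` times the norm of a jointly continuous function,
`continuous_fconv_family`). [folklore] -/
theorem measurable_phi (hpm : ∀ s, AEStronglyMeasurable (p s) volume)
    (hqm : ∀ s, AEStronglyMeasurable (q s) volume)
    (hp2 : ∀ s j, MemLp (p s · j) 2 volume) (hq2 : ∀ s j, MemLp (q s · j) 2 volume)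
    (hpc : ∀ j s₀, Tendsto (fun s => eLpNorm ((p s · j) - (p s₀ · j)) 2 volume) (𝓝 s₀) (𝓝 0))
    (hqc : ∀ j s₀, Tendsto (fun s => eLpNorm ((q s · j) - (q s₀ · j)) 2 volume) (𝓝 s₀) (𝓝 0))
    (C : ℝ≥0∞) :
    Measurable fun z : ℝ × EuclideanSpace ℝ ι => C * ‖fconv (fun η => ((∑ j, ‖p z.1 η j‖ : ℝ) : ℂ))
      (fun η => ((∑ j, ‖q z.1 η j‖ : ℝ) : ℂ)) z.2‖ₑ := by
  have h := continuous_fconv_family (X := ℝ) (F := fun s η => ((∑ j, ‖p s η j‖ : ℝ) : ℂ))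
    (G := fun s η => ((∑ j, ‖q s η j‖ : ℝ) : ℂ)) (fun s => memLp_majorantC (hpm s) (hp2 s))
    (fun s => memLp_majorantC (hqm s) (hq2 s))
    (fun s₀ => tendsto_eLpNorm_majorantC_sub hpm (fun j => hpc j s₀))
    (fun s₀ => tendsto_eLpNorm_majorantC_sub hqm (fun j => hqc j s₀))
  exact h.enorm.measurable.const_mul C

omit [DecidableEq ι] in
/-- Measurability in `s` of `φ_ξ(s)` at a fixed frequency. [folklore] -/
theorem measurable_phi_slice (hpm : ∀ s, AEStronglyMeasurable (p s) volume)
    (hqm : ∀ s, AEStronglyMeasurable (q s) volume)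
    (hp2 : ∀ s j, MemLp (p s · j) 2 volume) (hq2 : ∀ s j, MemLp (q s · j) 2 volume)
    (hpc : ∀ j s₀, Tendsto (fun s => eLpNorm ((p s · j) - (p s₀ · j)) 2 volume) (𝓝 s₀) (𝓝 0))
    (hqc : ∀ j s₀, Tendsto (fun s => eLpNorm ((q s · j) - (q s₀ · j)) 2 volume) (𝓝 s₀) (𝓝 0))
    (C : ℝ≥0∞) (ξ : EuclideanSpace ℝ ι) :
    Measurable fun s : ℝ => C * ‖fconv (fun η => ((∑ j, ‖p s η j‖ : ℝ) : ℂ))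
      (fun η => ((∑ j, ‖q s η j‖ : ℝ) : ℂ)) ξ‖ₑ := by
  have h := continuous_fconv_family (X := ℝ) (F := fun s η => ((∑ j, ‖p s η j‖ : ℝ) : ℂ))
    (G := fun s η => ((∑ j, ‖q s η j‖ : ℝ) : ℂ)) (fun s => memLp_majorantC (hpm s) (hp2 s))
    (fun s => memLp_majorantC (hqm s) (hq2 s))
    (fun s₀ => tendsto_eLpNorm_majorantC_sub hpm (fun j => hpc j s₀))
    (fun s₀ => tendsto_eLpNorm_majorantC_sub hqm (fun j => hqc j s₀))
  exact (h.comp₂ continuous_id continuous_const).enorm.measurable.const_mul C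

/-- **Sup bound for the bilinear Duhamel integral** at a fixed frequency: for `t ∈ [0, T]`,
`‖∫₀ᵗ heat(t-s) • N(p s, q s)(ξ) ds‖ₑ² ≤ (2c)⁻¹ ∫⁻_{(0,T]} φ_ξ(s)² ds`,
`φ_ξ(s) = 4π(card ι)² ‖(M_p(s) ⋆ M_q(s))(ξ)‖ₑ` (`enorm_duhamel_sq_le` with
`enorm_nonlin_le_majorantC`; Tao 2013, arXiv Lemma 23, (energy-duh2), Fourier form).
[cite: Tao2011, Lemma 2.1 (arXiv Lemma 23)] -/
theorem enorm_bilinDuhamel_sq_le (hc : 0 < c) (hpm : ∀ s, AEStronglyMeasurable (p s) volume)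
    (hqm : ∀ s, AEStronglyMeasurable (q s) volume)
    (hp2 : ∀ s j, MemLp (p s · j) 2 volume) (hq2 : ∀ s j, MemLp (q s · j) 2 volume)
    (hpc : ∀ j s₀, Tendsto (fun s => eLpNorm ((p s · j) - (p s₀ · j)) 2 volume) (𝓝 s₀) (𝓝 0))
    (hqc : ∀ j s₀, Tendsto (fun s => eLpNorm ((q s · j) - (q s₀ · j)) 2 volume) (𝓝 s₀) (𝓝 0))
    {t : ℝ} (ht : t ∈ Icc 0 T) (ξ : EuclideanSpace ℝ ι) :
    ‖∫ s in (0 : ℝ)..t, heat c ξ (t - s) • nonlin (p s) (q s) ξ‖ₑ ^ 2 ≤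
      ENNReal.ofReal (1 / (2 * c)) * ∫⁻ s in Ioc 0 T, (ENNReal.ofReal (4 * π) *
        (Fintype.card ι : ℝ≥0∞) ^ 2 * ‖fconv (fun η => ((∑ j, ‖p s η j‖ : ℝ) : ℂ))
          (fun η => ((∑ j, ‖q s η j‖ : ℝ) : ℂ)) ξ‖ₑ) ^ 2 :=
  enorm_duhamel_sq_le hc ((measurable_phi_slice hpm hqm hp2 hq2 hpc hqc _ ξ).aemeasurable)
    (fun s _ => enorm_nonlin_le_majorantC (hpm s) (hqm s) (hp2 s) (hq2 s) ξ) ht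

/-- **Low-frequency sup bound** for the bilinear Duhamel integral:
`‖∫₀ᵗ heat(t-s) • N(p s, q s)(ξ) ds‖ₑ² ≤ ‖ξ‖² T ∫⁻_{(0,T]} φ_ξ²` (`c ≥ 0`). [folklore] -/
theorem enorm_bilinDuhamel_sq_le_low (hc : 0 ≤ c) (hpm : ∀ s, AEStronglyMeasurable (p s) volume)
    (hqm : ∀ s, AEStronglyMeasurable (q s) volume)
    (hp2 : ∀ s j, MemLp (p s · j) 2 volume) (hq2 : ∀ s j, MemLp (q s · j) 2 volume)
    (hpc : ∀ j s₀, Tendsto (fun s => eLpNorm ((p s · j) - (p s₀ · j)) 2 volume) (𝓝 s₀) (𝓝 0))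
    (hqc : ∀ j s₀, Tendsto (fun s => eLpNorm ((q s · j) - (q s₀ · j)) 2 volume) (𝓝 s₀) (𝓝 0))
    {t : ℝ} (ht : t ∈ Icc 0 T) (ξ : EuclideanSpace ℝ ι) :
    ‖∫ s in (0 : ℝ)..t, heat c ξ (t - s) • nonlin (p s) (q s) ξ‖ₑ ^ 2 ≤
      ENNReal.ofReal (‖ξ‖ ^ 2 * T) * ∫⁻ s in Ioc 0 T, (ENNReal.ofReal (4 * π) *
        (Fintype.card ι : ℝ≥0∞) ^ 2 * ‖fconv (fun η => ((∑ j, ‖p s η j‖ : ℝ) : ℂ))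
          (fun η => ((∑ j, ‖q s η j‖ : ℝ) : ℂ)) ξ‖ₑ) ^ 2 :=
  enorm_duhamel_sq_le_low hc ((measurable_phi_slice hpm hqm hp2 hq2 hpc hqc _ ξ).aemeasurable)
    (fun s _ => enorm_nonlin_le_majorantC (hpm s) (hqm s) (hp2 s) (hq2 s) ξ) ht

/-- **`L²_t` (Schur) bound** for the bilinear Duhamel integral:
`c‖ξ‖⁴ ∫⁻_{(0,T]} ‖∫₀ᵗ heat(t-s) • N(p s, q s)(ξ) ds‖ₑ² dt ≤ c⁻¹‖ξ‖² ∫⁻_{(0,T]} φ_ξ²`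
(`lintegral_enorm_duhamel_sq_le`). [cite: Tao2011, Lemma 2.1 (arXiv Lemma 23)] -/
theorem lintegral_enorm_bilinDuhamel_sq_le (hc : 0 < c)
    (hpm : ∀ s, AEStronglyMeasurable (p s) volume) (hqm : ∀ s, AEStronglyMeasurable (q s) volume)
    (hp2 : ∀ s j, MemLp (p s · j) 2 volume) (hq2 : ∀ s j, MemLp (q s · j) 2 volume)
    (hpc : ∀ j s₀, Tendsto (fun s => eLpNorm ((p s · j) - (p s₀ · j)) 2 volume) (𝓝 s₀) (𝓝 0))
    (hqc : ∀ j s₀, Tendsto (fun s => eLpNorm ((q s · j) - (q s₀ · j)) 2 volume) (𝓝 s₀) (𝓝 0))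
    (ξ : EuclideanSpace ℝ ι) :
    ENNReal.ofReal (c * ‖ξ‖ ^ 4) *
        ∫⁻ t in Ioc 0 T, ‖∫ s in (0 : ℝ)..t, heat c ξ (t - s) • nonlin (p s) (q s) ξ‖ₑ ^ 2 ≤
      ENNReal.ofReal (c⁻¹ * ‖ξ‖ ^ 2) * ∫⁻ s in Ioc 0 T, (ENNReal.ofReal (4 * π) *
        (Fintype.card ι : ℝ≥0∞) ^ 2 * ‖fconv (fun η => ((∑ j, ‖p s η j‖ : ℝ) : ℂ))
          (fun η => ((∑ j, ‖q s η j‖ : ℝ) : ℂ)) ξ‖ₑ) ^ 2 :=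
  lintegral_enorm_duhamel_sq_le hc
    ((continuous_nonlin_time_of_tendsto hp2 hq2 hpc hqc ξ).aestronglyMeasurable)
    ((measurable_phi_slice hpm hqm hp2 hq2 hpc hqc _ ξ).aemeasurable)
    (fun s _ => enorm_nonlin_le_majorantC (hpm s) (hqm s) (hp2 s) (hq2 s) ξ)

/-- **Weighted envelope step** for the bilinear Duhamel integral: if the real majorants admit
pointwise envelopes on `[0, T]`, `‖M_p(s)‖ₑ ≤ G₀` and `e^{-λs}(1+‖η‖)^k ‖M_p(s)(η)‖ₑ ≤ G_k η`
(and the same for `q` with `H₀`, `H_k`), then for `t ∈ [0, T]`, `c, λ > 0`,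

  `e^{-λt} (1+‖ξ‖)^k ‖∫₀ᵗ heat(t-s) • N(p s, q s)(ξ) ds‖ₑ
     ≤ (2√(cλ))⁻¹ · 4π(card ι)² 2^k ((G₀ ⋆ₗ H_k)(ξ) + (G_k ⋆ₗ H₀)(ξ))`

(Peetre distributes the weight onto one factor, the exponential weight rides with it, and the
heat factor's `L¹_t` mass supplies the gain `exp_mul_enorm_duhamel_le`). This is the estimate by
which every higher Sobolev norm of the iterates is propagated on the whole interval once the
`L¹_ξ` size of the plain envelopes is under control. [folklore] -/
theorem exp_mul_weight_mul_enorm_bilinDuhamel_le (hc : 0 < c) {lam : ℝ} (hlam : 0 < lam)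
    (hpm : ∀ s, AEStronglyMeasurable (p s) volume) (hqm : ∀ s, AEStronglyMeasurable (q s) volume)
    (k : ℕ) {G₀ Gk H₀ Hk : EuclideanSpace ℝ ι → ℝ≥0∞}
    (hG₀ : ∀ s ∈ Icc 0 T, ∀ η, (∑ j, ‖p s η j‖ₑ) ≤ G₀ η)
    (hGk : ∀ s ∈ Icc 0 T, ∀ η, ENNReal.ofReal (Real.exp (-lam * s) * (1 + ‖η‖) ^ k) *
      (∑ j, ‖p s η j‖ₑ) ≤ Gk η)
    (hH₀ : ∀ s ∈ Icc 0 T, ∀ η, (∑ j, ‖q s η j‖ₑ) ≤ H₀ η)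
    (hHk : ∀ s ∈ Icc 0 T, ∀ η, ENNReal.ofReal (Real.exp (-lam * s) * (1 + ‖η‖) ^ k) *
      (∑ j, ‖q s η j‖ₑ) ≤ Hk η)
    {t : ℝ} (ht : t ∈ Icc 0 T) (ξ : EuclideanSpace ℝ ι) :
    ENNReal.ofReal (Real.exp (-lam * t)) * (ENNReal.ofReal ((1 + ‖ξ‖) ^ k) *
        ‖∫ s in (0 : ℝ)..t, heat c ξ (t - s) • nonlin (p s) (q s) ξ‖ₑ) ≤
      ENNReal.ofReal (1 / (2 * Real.sqrt (c * lam))) * (ENNReal.ofReal (4 * π) *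
        (Fintype.card ι : ℝ≥0∞) ^ 2 * 2 ^ k * ((G₀ ⋆ₗ Hk) ξ + (Gk ⋆ₗ H₀) ξ)) := by
  set W : ℝ := (1 + ‖ξ‖) ^ k with hW
  have hW0 : 0 ≤ W := by positivity
  -- sup norm from the components (`pi_norm_le_iff_of_nonneg`, through `toReal`)
  have hpi : ∀ {x : ι → ℂ} {b : ℝ≥0∞}, (∀ l, ‖x l‖ₑ ≤ b) → ‖x‖ₑ ≤ b := by
    intro x b h
    rcases eq_or_ne b ⊤ with hb | hb
    · rw [hb]; exact le_top
    rw [← ofReal_norm, ← ENNReal.ofReal_toReal hb]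
    refine ENNReal.ofReal_le_ofReal ((pi_norm_le_iff_of_nonneg ENNReal.toReal_nonneg).2 fun l => ?_)
    rw [← ENNReal.ofReal_le_ofReal_iff ENNReal.toReal_nonneg, ofReal_norm, ENNReal.ofReal_toReal hb]
    exact h l
  set C : ℝ≥0∞ := ENNReal.ofReal (4 * π) * (Fintype.card ι : ℝ≥0∞) ^ 2 with hC
  set P : ℝ → EuclideanSpace ℝ ι → ℝ≥0∞ := fun s η => ∑ j, ‖p s η j‖ₑ with hP
  set Q : ℝ → EuclideanSpace ℝ ι → ℝ≥0∞ := fun s η => ∑ j, ‖q s η j‖ₑ with hQ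
  have hPm : ∀ s, AEMeasurable (P s) volume := fun s => aemeasurable_majorant (hpm s)
  have hQm : ∀ s, AEMeasurable (Q s) volume := fun s => aemeasurable_majorant (hqm s)
  -- the rescaled nonlinearity `W • N`
  set N' : ℝ → (ι → ℂ) := fun s => W • nonlin (p s) (q s) ξ with hN'
  have hint : ∫ s in (0 : ℝ)..t, heat c ξ (t - s) • N' s =
      W • ∫ s in (0 : ℝ)..t, heat c ξ (t - s) • nonlin (p s) (q s) ξ := by
    rw [← intervalIntegral.integral_smul]
    refine intervalIntegral.integral_congr fun s _ => ?_
    simp only [hN']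
    rw [smul_comm]
  have hnormint : ‖∫ s in (0 : ℝ)..t, heat c ξ (t - s) • N' s‖ₑ =
      ENNReal.ofReal W * ‖∫ s in (0 : ℝ)..t, heat c ξ (t - s) • nonlin (p s) (q s) ξ‖ₑ := by
    rw [hint, enorm_smul, Real.enorm_eq_ofReal hW0]
  -- the hypotheses of the weighted time lemma
  set φ : ℝ → ℝ≥0∞ := fun s => ENNReal.ofReal W * (C * (P s ⋆ₗ Q s) ξ) with hφ
  have hN : ∀ s ∈ Icc 0 T, ‖N' s‖ₑ ≤ ENNReal.ofReal ‖ξ‖ * φ s := by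
    intro s _
    rw [hN', enorm_smul, Real.enorm_eq_ofReal hW0, hφ]
    calc ENNReal.ofReal W * ‖nonlin (p s) (q s) ξ‖ₑ
        ≤ ENNReal.ofReal W * (ENNReal.ofReal ‖ξ‖ * (C * (P s ⋆ₗ Q s) ξ)) := by
          gcongr
          refine hpi fun l => ?_
          calc ‖nonlin (p s) (q s) ξ l‖ₑ ≤ _ := enorm_nonlin_apply_le (p s) (q s) ξ l
            _ = ENNReal.ofReal ‖ξ‖ * (C * (P s ⋆ₗ Q s) ξ) := by rw [hC, hP, hQ]; ring
      _ = _ := by ring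
  have hΦ : ∀ s ∈ Icc 0 T, ENNReal.ofReal (Real.exp (-lam * s)) * φ s ≤
      C * 2 ^ k * ((G₀ ⋆ₗ Hk) ξ + (Gk ⋆ₗ H₀) ξ) := by
    intro s hs
    have hE0 : 0 ≤ Real.exp (-lam * s) := (Real.exp_pos _).le
    -- distribute the weight `W = (1+‖ξ‖)^k` onto the factors
    have hpeetre : ENNReal.ofReal W * (P s ⋆ₗ Q s) ξ ≤
        2 ^ k * ((P s ⋆ₗ fun η => ENNReal.ofReal ((1 + ‖η‖) ^ k) * Q s η) ξ +
          ((fun η => ENNReal.ofReal ((1 + ‖η‖) ^ k) * P s η) ⋆ₗ Q s) ξ) :=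
      weight_mul_lconv_le (hPm s) (hQm s) k ξ
    -- ride the exponential weight with the weighted factor and compare with the envelopes
    have h1 : ENNReal.ofReal (Real.exp (-lam * s)) *
        (P s ⋆ₗ fun η => ENNReal.ofReal ((1 + ‖η‖) ^ k) * Q s η) ξ ≤ (G₀ ⋆ₗ Hk) ξ := by
      rw [← lconv_const_mul_right _ ENNReal.ofReal_ne_top]
      refine lconv_mono (fun η => hG₀ s hs η) (fun η => ?_) ξ
      calc ENNReal.ofReal (Real.exp (-lam * s)) * (ENNReal.ofReal ((1 + ‖η‖) ^ k) * Q s η)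
          = ENNReal.ofReal (Real.exp (-lam * s) * (1 + ‖η‖) ^ k) * Q s η := by
            rw [ENNReal.ofReal_mul hE0, mul_assoc]
        _ ≤ Hk η := hHk s hs η
    have h2 : ENNReal.ofReal (Real.exp (-lam * s)) *
        ((fun η => ENNReal.ofReal ((1 + ‖η‖) ^ k) * P s η) ⋆ₗ Q s) ξ ≤ (Gk ⋆ₗ H₀) ξ := by
      rw [← lconv_const_mul_left _ ENNReal.ofReal_ne_top]
      refine lconv_mono (fun η => ?_) (fun η => hH₀ s hs η) ξ
      calc ENNReal.ofReal (Real.exp (-lam * s)) * (ENNReal.ofReal ((1 + ‖η‖) ^ k) * P s η)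
          = ENNReal.ofReal (Real.exp (-lam * s) * (1 + ‖η‖) ^ k) * P s η := by
            rw [ENNReal.ofReal_mul hE0, mul_assoc]
        _ ≤ Gk η := hGk s hs η
    calc ENNReal.ofReal (Real.exp (-lam * s)) * φ s
        = C * (ENNReal.ofReal (Real.exp (-lam * s)) * (ENNReal.ofReal W * (P s ⋆ₗ Q s) ξ)) := by
          rw [hφ]; ring
      _ ≤ C * (ENNReal.ofReal (Real.exp (-lam * s)) * (2 ^ k *
          ((P s ⋆ₗ fun η => ENNReal.ofReal ((1 + ‖η‖) ^ k) * Q s η) ξ +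
            ((fun η => ENNReal.ofReal ((1 + ‖η‖) ^ k) * P s η) ⋆ₗ Q s) ξ))) := by
          gcongr
      _ = C * 2 ^ k * (ENNReal.ofReal (Real.exp (-lam * s)) *
            (P s ⋆ₗ fun η => ENNReal.ofReal ((1 + ‖η‖) ^ k) * Q s η) ξ +
          ENNReal.ofReal (Real.exp (-lam * s)) *
            ((fun η => ENNReal.ofReal ((1 + ‖η‖) ^ k) * P s η) ⋆ₗ Q s) ξ) := by ring
      _ ≤ C * 2 ^ k * ((G₀ ⋆ₗ Hk) ξ + (Gk ⋆ₗ H₀) ξ) := by gcongr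
  have h := exp_mul_enorm_duhamel_le (N := N') (ξ := ξ) hc hlam hN hΦ ht
  rw [hnormint] at h
  calc ENNReal.ofReal (Real.exp (-lam * t)) * (ENNReal.ofReal ((1 + ‖ξ‖) ^ k) *
        ‖∫ s in (0 : ℝ)..t, heat c ξ (t - s) • nonlin (p s) (q s) ξ‖ₑ)
      ≤ ENNReal.ofReal (1 / (2 * Real.sqrt (c * lam))) * (C * 2 ^ k * ((G₀ ⋆ₗ Hk) ξ + (Gk ⋆ₗ H₀) ξ)) := h
    _ = _ := by rw [hC]

end Pointwise

/-! ### Moments of the real majorant (dimension three) -/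

section Moments

variable {u : EuclideanSpace ℝ (Fin 3) → Fin 3 → ℂ}

/-- `finrank ℝ ℝ³ = 3 < 4`: the inverse square weight `(1 + ‖ξ‖)^{-2}` is square integrable on
`ℝ³`. [folklore] -/
theorem finrank_three_lt_four : Module.finrank ℝ (EuclideanSpace ℝ (Fin 3)) < 2 * 2 := by
  rw [finrank_euclideanSpace_fin]; norm_num

/-- The extended norm of the real majorant is the majorant: `‖(∑ⱼ ‖u η j‖ : ℂ)‖ₑ = ∑ⱼ ‖u η j‖ₑ`.
[folklore] -/
theorem enorm_majorantC (u : EuclideanSpace ℝ (Fin 3) → Fin 3 → ℂ) (η : EuclideanSpace ℝ (Fin 3)) :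
    ‖(((∑ j, ‖u η j‖ : ℝ)) : ℂ)‖ₑ = ∑ j, ‖u η j‖ₑ := by
  rw [← ofReal_norm, Complex.norm_real, Real.norm_eq_abs,
    abs_of_nonneg (Finset.sum_nonneg fun j _ => norm_nonneg _),
    ENNReal.ofReal_sum_of_nonneg (fun j _ => norm_nonneg _)]
  simp only [ofReal_norm]

/-- Weighted square moments of the majorant from those of the components:
`∫⁻ (w^k ∑ⱼ‖uⱼ‖ₑ)² ≤ 3 ∑ⱼ ∫⁻ (w^k ‖uⱼ‖ₑ)²`. [folklore] -/
theorem lintegral_weight_majorant_sq_le (hu : AEStronglyMeasurable u volume) (W : EuclideanSpace ℝ (Fin 3) → ℝ≥0∞)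
    (hW : Measurable W) :
    ∫⁻ η, (W η * ∑ j, ‖u η j‖ₑ) ^ 2 ≤ 3 * ∑ j, ∫⁻ η, (W η * ‖u η j‖ₑ) ^ 2 := by
  calc ∫⁻ η, (W η * ∑ j, ‖u η j‖ₑ) ^ 2 ≤ ∫⁻ η, 3 * ∑ j, (W η * ‖u η j‖ₑ) ^ 2 := by
        refine lintegral_mono fun η => ?_
        rw [mul_pow]
        calc W η ^ 2 * (∑ j, ‖u η j‖ₑ) ^ 2 ≤ W η ^ 2 * ((Fintype.card (Fin 3) : ℝ≥0∞) *
            ∑ j, ‖u η j‖ₑ ^ 2) := by gcongr; exact majorant_sq_le u η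
          _ = 3 * ∑ j, (W η * ‖u η j‖ₑ) ^ 2 := by
              rw [Fintype.card_fin, Finset.mul_sum, Finset.mul_sum, Finset.mul_sum]
              push_cast
              refine Finset.sum_congr rfl fun j _ => ?_
              ring
    _ = 3 * ∑ j, ∫⁻ η, (W η * ‖u η j‖ₑ) ^ 2 := by
        rw [lintegral_const_mul' _ _ (by norm_num), lintegral_finsetSum' _ fun j _ => ?_]
        exact ((hW.aemeasurable.mul (aesm_apply hu j).enorm).pow_const 2)

/-- Finiteness of the weighted square moments of the majorant. [folklore] -/
theorem lintegral_weight_majorant_sq_lt_top (hu : AEStronglyMeasurable u volume) (k : ℕ)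
    (hk : ∀ j, ∫⁻ η, (ENNReal.ofReal ((1 + ‖η‖) ^ k) * ‖u η j‖ₑ) ^ 2 < ⊤) :
    ∫⁻ η, (ENNReal.ofReal ((1 + ‖η‖) ^ k) * ∑ j, ‖u η j‖ₑ) ^ 2 < ⊤ :=
  lt_of_le_of_lt (lintegral_weight_majorant_sq_le hu _ (measurable_ofReal_weight k))
    (ENNReal.mul_lt_top (by norm_num) (ENNReal.sum_lt_top.2 fun j _ => hk j))

/-- **`L¹` moments of the majorant from weighted `L²` moments** (Cauchy–Schwarz with the square
integrable `(1 + ‖ξ‖)^{-2}` on `ℝ³`): `∫⁻ w^k ∑ⱼ‖uⱼ‖ₑ < ∞` if `∫⁻ (w^{k+2} ‖uⱼ‖ₑ)² < ∞`.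
[folklore] -/
theorem lintegral_weight_majorant_lt_top (hu : AEStronglyMeasurable u volume) (k : ℕ)
    (hk : ∀ j, ∫⁻ η, (ENNReal.ofReal ((1 + ‖η‖) ^ (k + 2)) * ‖u η j‖ₑ) ^ 2 < ⊤) :
    ∫⁻ η, ENNReal.ofReal ((1 + ‖η‖) ^ k) * ∑ j, ‖u η j‖ₑ < ⊤ := by
  have hΦ : AEMeasurable (fun η => ENNReal.ofReal ((1 + ‖η‖) ^ k) * ∑ j, ‖u η j‖ₑ) volume :=
    (measurable_ofReal_weight k).aemeasurable.mul (aemeasurable_majorant hu)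
  have h := sq_lintegral_le_weight hΦ 2
  have hfin : (∫⁻ ξ : EuclideanSpace ℝ (Fin 3), (ENNReal.ofReal ((1 + ‖ξ‖) ^ 2))⁻¹ ^ 2) *
      ∫⁻ ξ, (ENNReal.ofReal ((1 + ‖ξ‖) ^ 2) * (ENNReal.ofReal ((1 + ‖ξ‖) ^ k) *
        ∑ j, ‖u ξ j‖ₑ)) ^ 2 < ⊤ := by
    refine ENNReal.mul_lt_top (lintegral_weight_inv_sq_lt_top finrank_three_lt_four) ?_
    refine lt_of_le_of_lt (le_of_eq (lintegral_congr fun ξ => ?_))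
      (lintegral_weight_majorant_sq_lt_top hu (k + 2) hk)
    rw [← mul_assoc, ← ENNReal.ofReal_mul (by positivity), ← pow_add, add_comm 2 k]
  have h2 : (∫⁻ η, ENNReal.ofReal ((1 + ‖η‖) ^ k) * ∑ j, ‖u η j‖ₑ) ^ 2 < ⊤ := lt_of_le_of_lt h hfin
  by_contra htop
  rw [not_lt, top_le_iff] at htop
  rw [htop] at h2
  simp at h2

/-- Real-variable integrability of the moments `‖η‖ⁿ · (weighted majorant)` of the real
majorant: `Integrable (fun η => ‖η‖^n * ‖(w^m ∑ⱼ‖uⱼ‖ : ℂ)‖)`-type statements are all instances of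
the following: for a non-negative real function dominated by `w^k ∑ⱼ ‖uⱼ‖`, integrability follows
from `lintegral_weight_majorant_lt_top`. [folklore] -/
theorem integrable_of_le_weight_majorant (hu : AEStronglyMeasurable u volume) (k : ℕ)
    (hk : ∀ j, ∫⁻ η, (ENNReal.ofReal ((1 + ‖η‖) ^ (k + 2)) * ‖u η j‖ₑ) ^ 2 < ⊤)
    {g : EuclideanSpace ℝ (Fin 3) → ℝ} (hgm : AEStronglyMeasurable g volume)
    (hg0 : ∀ η, 0 ≤ g η) (hg : ∀ η, g η ≤ (1 + ‖η‖) ^ k * ∑ j, ‖u η j‖) : Integrable g := by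
  refine ⟨hgm, ?_⟩
  rw [hasFiniteIntegral_iff_enorm]
  refine lt_of_le_of_lt (lintegral_mono fun η => ?_) (lintegral_weight_majorant_lt_top hu k hk)
  rw [Real.enorm_eq_ofReal (hg0 η)]
  calc ENNReal.ofReal (g η) ≤ ENNReal.ofReal ((1 + ‖η‖) ^ k * ∑ j, ‖u η j‖) :=
        ENNReal.ofReal_le_ofReal (hg η)
    _ = ENNReal.ofReal ((1 + ‖η‖) ^ k) * ∑ j, ‖u η j‖ₑ := by
        rw [ENNReal.ofReal_mul (by positivity), ENNReal.ofReal_sum_of_nonneg (fun j _ => norm_nonneg _)]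
        simp only [ofReal_norm]

end Moments

/-! ### The level-one (`Ḣ¹`) bilinear bound at a fixed time (dimension three) -/

section LevelOne

variable {u u' : EuclideanSpace ℝ (Fin 3) → Fin 3 → ℂ}

/-- **One asymmetric term of the level-one bound**: for fields `u, u'` on `ℝ³` with all weighted
square moments finite and real majorants `F, F'`,
`‖((ρ‖F‖ₑ) ⋆ₗ ‖F'‖ₑ)‖²_{L²_ξ} ≤ C_S² ‖ρF‖₂ ‖ρ²F‖₂ ‖ρF'‖₂²` — the squared form of
`eLpNorm_lconv_norm_weight_le` with its integrability hypotheses discharged from the moments.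
[cite: Tao2011, Lemma 2.1 (arXiv Lemma 23)] -/
theorem lintegral_lconv_norm_majorant_sq_le (hu : AEStronglyMeasurable u volume)
    (hu' : AEStronglyMeasurable u' volume)
    (hw : ∀ (k : ℕ) j, ∫⁻ η, (ENNReal.ofReal ((1 + ‖η‖) ^ k) * ‖u η j‖ₑ) ^ 2 < ⊤)
    (hw' : ∀ (k : ℕ) j, ∫⁻ η, (ENNReal.ofReal ((1 + ‖η‖) ^ k) * ‖u' η j‖ₑ) ^ 2 < ⊤) :
    ∫⁻ ξ, (((fun η => ENNReal.ofReal ‖η‖ * ∑ j, ‖u η j‖ₑ) ⋆ₗ (fun η => ∑ j, ‖u' η j‖ₑ)) ξ) ^ 2 ≤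
      ((SNormLESNormFDerivOfEqConst ℂ (volume : Measure (EuclideanSpace ℝ (Fin 3))) 2 *
          ENNReal.ofReal (2 * π)) ^ (3 / 2 : ℝ)) ^ 2 *
        (eLpNorm (fun η : EuclideanSpace ℝ (Fin 3) => ENNReal.ofReal ‖η‖ * ∑ j, ‖u η j‖ₑ) 2 volume *
         eLpNorm (fun η : EuclideanSpace ℝ (Fin 3) => ENNReal.ofReal (‖η‖ ^ 2) * ∑ j, ‖u η j‖ₑ) 2 volume *
         eLpNorm (fun η : EuclideanSpace ℝ (Fin 3) => ENNReal.ofReal ‖η‖ * ∑ j, ‖u' η j‖ₑ) 2 volume ^ 2) := by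
  set F : EuclideanSpace ℝ (Fin 3) → ℂ := fun η => ((∑ j, ‖u η j‖ : ℝ) : ℂ) with hF
  set F' : EuclideanSpace ℝ (Fin 3) → ℂ := fun η => ((∑ j, ‖u' η j‖ : ℝ) : ℂ) with hF'
  have hFe : ∀ η, ‖F η‖ₑ = ∑ j, ‖u η j‖ₑ := fun η => enorm_majorantC u η
  have hFe' : ∀ η, ‖F' η‖ₑ = ∑ j, ‖u' η j‖ₑ := fun η => enorm_majorantC u' η
  have hFn : ∀ η, ‖F η‖ = ∑ j, ‖u η j‖ := fun η => by
    rw [hF]; simp only [Complex.norm_real, Real.norm_eq_abs]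
    exact abs_of_nonneg (Finset.sum_nonneg fun j _ => norm_nonneg _)
  have hFn' : ∀ η, ‖F' η‖ = ∑ j, ‖u' η j‖ := fun η => by
    rw [hF']; simp only [Complex.norm_real, Real.norm_eq_abs]
    exact abs_of_nonneg (Finset.sum_nonneg fun j _ => norm_nonneg _)
  have hFm : AEStronglyMeasurable F volume := aestronglyMeasurable_majorantC hu
  have hFm' : AEStronglyMeasurable F' volume := aestronglyMeasurable_majorantC hu'
  -- the hypotheses of `eLpNorm_lconv_norm_weight_le`
  have hwk : ∀ k, ∀ j, ∫⁻ η, (ENNReal.ofReal ((1 + ‖η‖) ^ (k + 2)) * ‖u η j‖ₑ) ^ 2 < ⊤ :=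
    fun k j => hw (k + 2) j
  have hwk' : ∀ k, ∀ j, ∫⁻ η, (ENNReal.ofReal ((1 + ‖η‖) ^ (k + 2)) * ‖u' η j‖ₑ) ^ 2 < ⊤ :=
    fun k j => hw' (k + 2) j
  have hle1 : ∀ (η : EuclideanSpace ℝ (Fin 3)) (n : ℕ), ‖η‖ ^ n ≤ (1 + ‖η‖) ^ n := fun η n =>
    pow_le_pow_left₀ (norm_nonneg _) (by linarith [norm_nonneg η]) n
  have hmn : AEStronglyMeasurable (fun η : EuclideanSpace ℝ (Fin 3) => ‖η‖) volume :=
    continuous_norm.aestronglyMeasurable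
  have hf1 : Integrable (fun η : EuclideanSpace ℝ (Fin 3) => ‖η‖ * ‖F η‖) :=
    integrable_of_le_weight_majorant hu 1 (hwk 1) (hmn.mul hFm.norm)
      (fun η => by positivity) (fun η => by rw [hFn, pow_one]; gcongr; linarith [norm_nonneg η])
  have hf2 : Integrable (fun η : EuclideanSpace ℝ (Fin 3) => ‖η‖ ^ 2 * ‖F η‖) :=
    integrable_of_le_weight_majorant hu 2 (hwk 2) ((hmn.pow 2).mul hFm.norm)
      (fun η => by positivity) (fun η => by rw [hFn]; gcongr; linarith [norm_nonneg η])
  have hg0 : Integrable F' := by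
    have h := integrable_of_le_weight_majorant hu' 0 (hwk' 0) hFm'.norm (fun η => norm_nonneg _)
      (fun η => by rw [hFn', pow_zero, one_mul])
    exact ⟨hFm', h.2.congr' (Eventually.of_forall fun η => by simp)⟩
  have hg1 : Integrable (fun η : EuclideanSpace ℝ (Fin 3) => ‖η‖ * ‖F' η‖) :=
    integrable_of_le_weight_majorant hu' 1 (hwk' 1) (hmn.mul hFm'.norm)
      (fun η => by positivity) (fun η => by rw [hFn', pow_one]; gcongr; linarith [norm_nonneg η])
  -- weighted square norms: `ρⁿ ≤ wⁿ`
  have hsqF : ∀ n : ℕ, ∫⁻ η : EuclideanSpace ℝ (Fin 3), (ENNReal.ofReal (‖η‖ ^ n) * ‖F η‖ₑ) ^ 2 < ⊤ := by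
    intro n
    refine lt_of_le_of_lt (lintegral_mono fun η => ?_) (lintegral_weight_majorant_sq_lt_top hu n (hw n))
    rw [hFe]
    exact pow_le_pow_left' (mul_le_mul' (ENNReal.ofReal_le_ofReal (hle1 η n)) le_rfl) 2
  have hsqF' : ∀ n : ℕ, ∫⁻ η : EuclideanSpace ℝ (Fin 3), (ENNReal.ofReal (‖η‖ ^ n) * ‖F' η‖ₑ) ^ 2 < ⊤ := by
    intro n
    refine lt_of_le_of_lt (lintegral_mono fun η => ?_) (lintegral_weight_majorant_sq_lt_top hu' n (hw' n))
    rw [hFe']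
    exact pow_le_pow_left' (mul_le_mul' (ENNReal.ofReal_le_ofReal (hle1 η n)) le_rfl) 2
  have hfL2 : ∫⁻ η : EuclideanSpace ℝ (Fin 3), (ENNReal.ofReal ‖η‖ * ‖F η‖ₑ) ^ 2 < ⊤ := by
    simpa using hsqF 1
  have hg1L2 : ∫⁻ η : EuclideanSpace ℝ (Fin 3), (ENNReal.ofReal ‖η‖ * ‖F' η‖ₑ) ^ 2 < ⊤ := by
    simpa using hsqF' 1
  have hgL2 : MemLp F' 2 volume := by
    refine ⟨hFm', ?_⟩
    rw [← lintegral_enorm_sq_rpow_half_eq_eLpNorm]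
    refine ENNReal.rpow_lt_top_of_nonneg (by norm_num) (ne_of_lt ?_)
    simpa using hsqF' 0
  -- the estimate of `FourierL2Sobolev`
  have hmain := eLpNorm_lconv_norm_weight_le hFm hFm' hf1 hf2 hfL2 (hsqF 2) hg0 hg1 hgL2 hg1L2
  -- translate `‖F‖ₑ`, `‖F'‖ₑ` into the majorants and square
  set K3 : ℝ≥0∞ := (SNormLESNormFDerivOfEqConst ℂ (volume : Measure (EuclideanSpace ℝ (Fin 3))) 2 *
    ENNReal.ofReal (2 * π)) ^ (3 / 2 : ℝ) with hK3
  set a := eLpNorm (fun η : EuclideanSpace ℝ (Fin 3) => ENNReal.ofReal ‖η‖ * ∑ j, ‖u η j‖ₑ) 2 volume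
    with ha
  set b := eLpNorm (fun η : EuclideanSpace ℝ (Fin 3) => ENNReal.ofReal (‖η‖ ^ 2) * ∑ j, ‖u η j‖ₑ) 2 volume
    with hb
  set a' := eLpNorm (fun η : EuclideanSpace ℝ (Fin 3) => ENNReal.ofReal ‖η‖ * ∑ j, ‖u' η j‖ₑ) 2 volume
    with ha'
  have e1 : eLpNorm (fun η : EuclideanSpace ℝ (Fin 3) => ENNReal.ofReal ‖η‖ * ‖F η‖ₑ) 2 volume = a := by
    simp_rw [hFe]; exact ha.symm
  have e2 : eLpNorm (fun η : EuclideanSpace ℝ (Fin 3) => ENNReal.ofReal (‖η‖ ^ 2) * ‖F η‖ₑ) 2 volume = b := by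
    simp_rw [hFe]; exact hb.symm
  have e3 : eLpNorm (fun η : EuclideanSpace ℝ (Fin 3) => ENNReal.ofReal ‖η‖ * ‖F' η‖ₑ) 2 volume = a' := by
    simp_rw [hFe']; exact ha'.symm
  rw [e1, e2, e3] at hmain
  have hlhs : ∫⁻ ξ, (((fun η => ENNReal.ofReal ‖η‖ * ∑ j, ‖u η j‖ₑ) ⋆ₗ (fun η => ∑ j, ‖u' η j‖ₑ)) ξ) ^ 2 =
      eLpNorm (fun ξ => ((fun η => ENNReal.ofReal ‖η‖ * ‖F η‖ₑ) ⋆ₗ (fun η => ‖F' η‖ₑ)) ξ) 2 volume ^ 2 := by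
    rw [← lintegral_enorm_sq_eq_eLpNorm_sq]
    simp_rw [enorm_eq_self, hFe, hFe']
  rw [hlhs]
  calc eLpNorm (fun ξ => ((fun η => ENNReal.ofReal ‖η‖ * ‖F η‖ₑ) ⋆ₗ (fun η => ‖F' η‖ₑ)) ξ) 2 volume ^ 2
      ≤ (K3 * a ^ (1 / 2 : ℝ) * b ^ (1 / 2 : ℝ) * a') ^ 2 := pow_le_pow_left' hmain 2
    _ = K3 ^ 2 * (a * b * a' ^ 2) := by
        have hh : ∀ x : ℝ≥0∞, (x ^ (1 / 2 : ℝ)) ^ 2 = x := fun x => by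
          rw [← ENNReal.rpow_natCast, ← ENNReal.rpow_mul]; norm_num
        rw [mul_pow, mul_pow, mul_pow, hh, hh]; ring

/-- **The level-one bound at a fixed time, symmetrised**:
`∫⁻ (ρ‖(F ⋆ F')(ξ)‖ₑ)² dξ ≤ 2K₃²(a b a'² + a' b' a²)`, `a = ‖ρF‖₂`, `b = ‖ρ²F‖₂`, `a', b'` for
`F'` (`ρ(|F| ⋆ |F'|) ≤ (ρ|F|) ⋆ |F'| + (ρ|F'|) ⋆ |F|` and the asymmetric bound for each term).
[cite: Tao2011, Lemma 2.1 (arXiv Lemma 23)] -/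
theorem lintegral_norm_mul_fconv_majorant_sq_le (hu : AEStronglyMeasurable u volume)
    (hu' : AEStronglyMeasurable u' volume)
    (h2 : ∀ j, MemLp (u · j) 2 volume) (h2' : ∀ j, MemLp (u' · j) 2 volume)
    (hw : ∀ (k : ℕ) j, ∫⁻ η, (ENNReal.ofReal ((1 + ‖η‖) ^ k) * ‖u η j‖ₑ) ^ 2 < ⊤)
    (hw' : ∀ (k : ℕ) j, ∫⁻ η, (ENNReal.ofReal ((1 + ‖η‖) ^ k) * ‖u' η j‖ₑ) ^ 2 < ⊤) :
    ∫⁻ ξ, (ENNReal.ofReal ‖ξ‖ * ‖fconv (fun η => ((∑ j, ‖u η j‖ : ℝ) : ℂ))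
        (fun η => ((∑ j, ‖u' η j‖ : ℝ) : ℂ)) ξ‖ₑ) ^ 2 ≤
      2 * ((SNormLESNormFDerivOfEqConst ℂ (volume : Measure (EuclideanSpace ℝ (Fin 3))) 2 *
          ENNReal.ofReal (2 * π)) ^ (3 / 2 : ℝ)) ^ 2 *
        (eLpNorm (fun η : EuclideanSpace ℝ (Fin 3) => ENNReal.ofReal ‖η‖ * ∑ j, ‖u η j‖ₑ) 2 volume *
           eLpNorm (fun η : EuclideanSpace ℝ (Fin 3) => ENNReal.ofReal (‖η‖ ^ 2) * ∑ j, ‖u η j‖ₑ) 2 volume *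
           eLpNorm (fun η : EuclideanSpace ℝ (Fin 3) => ENNReal.ofReal ‖η‖ * ∑ j, ‖u' η j‖ₑ) 2 volume ^ 2 +
         eLpNorm (fun η : EuclideanSpace ℝ (Fin 3) => ENNReal.ofReal ‖η‖ * ∑ j, ‖u' η j‖ₑ) 2 volume *
           eLpNorm (fun η : EuclideanSpace ℝ (Fin 3) => ENNReal.ofReal (‖η‖ ^ 2) * ∑ j, ‖u' η j‖ₑ) 2 volume *
           eLpNorm (fun η : EuclideanSpace ℝ (Fin 3) => ENNReal.ofReal ‖η‖ * ∑ j, ‖u η j‖ₑ) 2 volume ^ 2) := by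
  set P : EuclideanSpace ℝ (Fin 3) → ℝ≥0∞ := fun η => ∑ j, ‖u η j‖ₑ with hP
  set Q : EuclideanSpace ℝ (Fin 3) → ℝ≥0∞ := fun η => ∑ j, ‖u' η j‖ₑ with hQ
  have hPm : AEMeasurable P volume := aemeasurable_majorant hu
  have hQm : AEMeasurable Q volume := aemeasurable_majorant hu'
  set X : EuclideanSpace ℝ (Fin 3) → ℝ≥0∞ := fun ξ => ((fun η => ENNReal.ofReal ‖η‖ * P η) ⋆ₗ Q) ξ with hX
  set Y : EuclideanSpace ℝ (Fin 3) → ℝ≥0∞ := fun ξ => ((fun η => ENNReal.ofReal ‖η‖ * Q η) ⋆ₗ P) ξ with hY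
  -- pointwise: `ρ ‖F ⋆ F'‖ₑ ≤ X + Y`
  have hpt : ∀ ξ, ENNReal.ofReal ‖ξ‖ * ‖fconv (fun η => ((∑ j, ‖u η j‖ : ℝ) : ℂ))
      (fun η => ((∑ j, ‖u' η j‖ : ℝ) : ℂ)) ξ‖ₑ ≤ X ξ + Y ξ := by
    intro ξ
    rw [← lconv_majorant_eq_enorm_fconv hu hu' h2 h2' ξ]
    refine (norm_mul_lconv_le hPm hQm ξ).trans (le_of_eq ?_)
    rw [hX, hY]
    simp only
    congr 1
    exact congrFun (lconvolution_comm (f := P) (g := fun η => ENNReal.ofReal ‖η‖ * Q η)) ξ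
  set K3 : ℝ≥0∞ := (SNormLESNormFDerivOfEqConst ℂ (volume : Measure (EuclideanSpace ℝ (Fin 3))) 2 *
    ENNReal.ofReal (2 * π)) ^ (3 / 2 : ℝ) with hK3
  set a := eLpNorm (fun η : EuclideanSpace ℝ (Fin 3) => ENNReal.ofReal ‖η‖ * ∑ j, ‖u η j‖ₑ) 2 volume
    with ha
  set b := eLpNorm (fun η : EuclideanSpace ℝ (Fin 3) => ENNReal.ofReal (‖η‖ ^ 2) * ∑ j, ‖u η j‖ₑ) 2 volume
    with hb
  set a' := eLpNorm (fun η : EuclideanSpace ℝ (Fin 3) => ENNReal.ofReal ‖η‖ * ∑ j, ‖u' η j‖ₑ) 2 volume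
    with ha'
  set b' := eLpNorm (fun η : EuclideanSpace ℝ (Fin 3) => ENNReal.ofReal (‖η‖ ^ 2) * ∑ j, ‖u' η j‖ₑ) 2 volume
    with hb'
  have hX2 : ∫⁻ ξ, X ξ ^ 2 ≤ K3 ^ 2 * (a * b * a' ^ 2) := lintegral_lconv_norm_majorant_sq_le hu hu' hw hw'
  have hY2 : ∫⁻ ξ, Y ξ ^ 2 ≤ K3 ^ 2 * (a' * b' * a ^ 2) := lintegral_lconv_norm_majorant_sq_le hu' hu hw' hw
  have hXm : AEMeasurable X volume :=
    aemeasurable_lconvolution (((ENNReal.continuous_ofReal.comp continuous_norm).measurable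
      ).aemeasurable.mul hPm) hQm
  calc ∫⁻ ξ, (ENNReal.ofReal ‖ξ‖ * ‖fconv (fun η => ((∑ j, ‖u η j‖ : ℝ) : ℂ))
        (fun η => ((∑ j, ‖u' η j‖ : ℝ) : ℂ)) ξ‖ₑ) ^ 2
      ≤ ∫⁻ ξ, (X ξ + Y ξ) ^ 2 := lintegral_mono fun ξ => pow_le_pow_left' (hpt ξ) 2
    _ ≤ ∫⁻ ξ, (2 * X ξ ^ 2 + 2 * Y ξ ^ 2) := lintegral_mono fun ξ => by
        have hsq : ∀ a b : ℝ≥0∞, (a + b) ^ 2 ≤ 2 * (a ^ 2 + b ^ 2) := fun a b => by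
          have h := ENNReal.rpow_add_le_mul_rpow_add_rpow a b (p := 2) (by norm_num)
          norm_num at h
          exact_mod_cast h
        rw [← mul_add]; exact hsq _ _
    _ = 2 * (∫⁻ ξ, X ξ ^ 2) + 2 * (∫⁻ ξ, Y ξ ^ 2) := by
        rw [lintegral_add_left' ((hXm.pow_const 2).const_mul 2)]
        congr 1 <;> exact lintegral_const_mul' _ _ (by norm_num)
    _ ≤ 2 * (K3 ^ 2 * (a * b * a' ^ 2)) + 2 * (K3 ^ 2 * (a' * b' * a ^ 2)) :=
        add_le_add (mul_le_mul' le_rfl hX2) (mul_le_mul' le_rfl hY2)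
    _ = _ := by ring

end LevelOne

/-! ### The level-two (`Ḣ²`) bilinear bound at a fixed time (dimension three) -/

section LevelTwo

variable {u u' : EuclideanSpace ℝ (Fin 3) → Fin 3 → ℂ}

/-- **One asymmetric term of the level-two bound**: with `F, F'` the real majorants,
`‖((ρ²‖F‖ₑ) ⋆ₗ ‖F'‖ₑ)‖²_{L²_ξ} ≤ K₃² ‖ρ²F‖₂ ‖ρ³F‖₂ ‖ρF'‖₂²` (`eLpNorm_lconv_norm_weight_le` applied
to `ρF` and `F'`). [cite: Tao2011, Lemma 2.1 (arXiv Lemma 23)] -/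
theorem lintegral_lconv_norm_sq_majorant_sq_le (hu : AEStronglyMeasurable u volume)
    (hu' : AEStronglyMeasurable u' volume)
    (hw : ∀ (k : ℕ) j, ∫⁻ η, (ENNReal.ofReal ((1 + ‖η‖) ^ k) * ‖u η j‖ₑ) ^ 2 < ⊤)
    (hw' : ∀ (k : ℕ) j, ∫⁻ η, (ENNReal.ofReal ((1 + ‖η‖) ^ k) * ‖u' η j‖ₑ) ^ 2 < ⊤) :
    ∫⁻ ξ, (((fun η => ENNReal.ofReal (‖η‖ ^ 2) * ∑ j, ‖u η j‖ₑ) ⋆ₗ (fun η => ∑ j, ‖u' η j‖ₑ)) ξ) ^ 2 ≤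
      ((SNormLESNormFDerivOfEqConst ℂ (volume : Measure (EuclideanSpace ℝ (Fin 3))) 2 *
          ENNReal.ofReal (2 * π)) ^ (3 / 2 : ℝ)) ^ 2 *
        (eLpNorm (fun η : EuclideanSpace ℝ (Fin 3) => ENNReal.ofReal (‖η‖ ^ 2) * ∑ j, ‖u η j‖ₑ) 2 volume *
         eLpNorm (fun η : EuclideanSpace ℝ (Fin 3) => ENNReal.ofReal (‖η‖ ^ 3) * ∑ j, ‖u η j‖ₑ) 2 volume *
         eLpNorm (fun η : EuclideanSpace ℝ (Fin 3) => ENNReal.ofReal ‖η‖ * ∑ j, ‖u' η j‖ₑ) 2 volume ^ 2) := by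
  -- the weighted real majorant `f = ρ F` and the plain `F'`
  set f : EuclideanSpace ℝ (Fin 3) → ℂ := fun η => ((‖η‖ * ∑ j, ‖u η j‖ : ℝ) : ℂ) with hf
  set F' : EuclideanSpace ℝ (Fin 3) → ℂ := fun η => ((∑ j, ‖u' η j‖ : ℝ) : ℂ) with hF'
  have hfn : ∀ η, ‖f η‖ = ‖η‖ * ∑ j, ‖u η j‖ := fun η => by
    rw [hf]; simp only [Complex.norm_real, Real.norm_eq_abs]
    exact abs_of_nonneg (mul_nonneg (norm_nonneg _) (Finset.sum_nonneg fun j _ => norm_nonneg _))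
  have hfe : ∀ η, ‖f η‖ₑ = ENNReal.ofReal ‖η‖ * ∑ j, ‖u η j‖ₑ := fun η => by
    rw [← ofReal_norm, hfn, ENNReal.ofReal_mul (norm_nonneg _),
      ENNReal.ofReal_sum_of_nonneg (fun j _ => norm_nonneg _)]
    simp only [ofReal_norm]
  have hFe' : ∀ η, ‖F' η‖ₑ = ∑ j, ‖u' η j‖ₑ := fun η => enorm_majorantC u' η
  have hFn' : ∀ η, ‖F' η‖ = ∑ j, ‖u' η j‖ := fun η => by
    rw [hF']; simp only [Complex.norm_real, Real.norm_eq_abs]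
    exact abs_of_nonneg (Finset.sum_nonneg fun j _ => norm_nonneg _)
  have hmn : AEStronglyMeasurable (fun η : EuclideanSpace ℝ (Fin 3) => ‖η‖) volume :=
    continuous_norm.aestronglyMeasurable
  have hfm : AEStronglyMeasurable f volume :=
    Complex.continuous_ofReal.comp_aestronglyMeasurable (hmn.mul
      (Finset.aestronglyMeasurable_fun_sum _ fun j _ => (aesm_apply hu j).norm))
  have hFm' : AEStronglyMeasurable F' volume := aestronglyMeasurable_majorantC hu'
  have hwk : ∀ k, ∀ j, ∫⁻ η, (ENNReal.ofReal ((1 + ‖η‖) ^ (k + 2)) * ‖u η j‖ₑ) ^ 2 < ⊤ :=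
    fun k j => hw (k + 2) j
  have hwk' : ∀ k, ∀ j, ∫⁻ η, (ENNReal.ofReal ((1 + ‖η‖) ^ (k + 2)) * ‖u' η j‖ₑ) ^ 2 < ⊤ :=
    fun k j => hw' (k + 2) j
  have hle1 : ∀ (η : EuclideanSpace ℝ (Fin 3)) (n : ℕ), ‖η‖ ^ n ≤ (1 + ‖η‖) ^ n := fun η n =>
    pow_le_pow_left₀ (norm_nonneg _) (by linarith [norm_nonneg η]) n
  -- integrability hypotheses of `eLpNorm_lconv_norm_weight_le`
  have hf1 : Integrable (fun η : EuclideanSpace ℝ (Fin 3) => ‖η‖ * ‖f η‖) :=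
    integrable_of_le_weight_majorant hu 2 (hwk 2) (hmn.mul hfm.norm)
      (fun η => by positivity) (fun η => by
        rw [hfn, ← mul_assoc, ← sq]
        exact mul_le_mul_of_nonneg_right (hle1 η 2) (Finset.sum_nonneg fun j _ => norm_nonneg _))
  have hf2 : Integrable (fun η : EuclideanSpace ℝ (Fin 3) => ‖η‖ ^ 2 * ‖f η‖) :=
    integrable_of_le_weight_majorant hu 3 (hwk 3) ((hmn.pow 2).mul hfm.norm)
      (fun η => by positivity) (fun η => by
        rw [hfn, ← mul_assoc, ← pow_succ]
        exact mul_le_mul_of_nonneg_right (hle1 η 3) (Finset.sum_nonneg fun j _ => norm_nonneg _))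
  have hg0 : Integrable F' := by
    have h := integrable_of_le_weight_majorant hu' 0 (hwk' 0) hFm'.norm (fun η => norm_nonneg _)
      (fun η => by rw [hFn', pow_zero, one_mul])
    exact ⟨hFm', h.2.congr' (Eventually.of_forall fun η => by simp)⟩
  have hg1 : Integrable (fun η : EuclideanSpace ℝ (Fin 3) => ‖η‖ * ‖F' η‖) :=
    integrable_of_le_weight_majorant hu' 1 (hwk' 1) (hmn.mul hFm'.norm)
      (fun η => by positivity) (fun η => by rw [hFn', pow_one]; gcongr; linarith [norm_nonneg η])
  have hsqF : ∀ n : ℕ, ∫⁻ η : EuclideanSpace ℝ (Fin 3), (ENNReal.ofReal (‖η‖ ^ n) * ∑ j, ‖u η j‖ₑ) ^ 2 < ⊤ := by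
    intro n
    refine lt_of_le_of_lt (lintegral_mono fun η => ?_) (lintegral_weight_majorant_sq_lt_top hu n (hw n))
    exact pow_le_pow_left' (mul_le_mul' (ENNReal.ofReal_le_ofReal (hle1 η n)) le_rfl) 2
  have hsqF' : ∀ n : ℕ, ∫⁻ η : EuclideanSpace ℝ (Fin 3), (ENNReal.ofReal (‖η‖ ^ n) * ‖F' η‖ₑ) ^ 2 < ⊤ := by
    intro n
    refine lt_of_le_of_lt (lintegral_mono fun η => ?_) (lintegral_weight_majorant_sq_lt_top hu' n (hw' n))
    rw [hFe']
    exact pow_le_pow_left' (mul_le_mul' (ENNReal.ofReal_le_ofReal (hle1 η n)) le_rfl) 2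
  have hpow : ∀ (η : EuclideanSpace ℝ (Fin 3)) (n : ℕ), ENNReal.ofReal (‖η‖ ^ n) * ‖f η‖ₑ =
      ENNReal.ofReal (‖η‖ ^ (n + 1)) * ∑ j, ‖u η j‖ₑ := fun η n => by
    rw [hfe, ← mul_assoc, ← ENNReal.ofReal_mul (by positivity), ← pow_succ]
  have hpow1 : ∀ (η : EuclideanSpace ℝ (Fin 3)), ENNReal.ofReal ‖η‖ * ‖f η‖ₑ =
      ENNReal.ofReal (‖η‖ ^ 2) * ∑ j, ‖u η j‖ₑ := fun η => by
    rw [hfe, ← mul_assoc, ← ENNReal.ofReal_mul (norm_nonneg _), ← sq]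
  have hfL2 : ∫⁻ η : EuclideanSpace ℝ (Fin 3), (ENNReal.ofReal ‖η‖ * ‖f η‖ₑ) ^ 2 < ⊤ := by
    have := hsqF 2
    refine lt_of_le_of_lt (le_of_eq (lintegral_congr fun η => ?_)) this
    rw [hpow1 η]
  have hf2L2 : ∫⁻ η : EuclideanSpace ℝ (Fin 3), (ENNReal.ofReal (‖η‖ ^ 2) * ‖f η‖ₑ) ^ 2 < ⊤ := by
    have := hsqF 3
    refine lt_of_le_of_lt (le_of_eq (lintegral_congr fun η => ?_)) this
    rw [hpow η 2]
  have hg1L2 : ∫⁻ η : EuclideanSpace ℝ (Fin 3), (ENNReal.ofReal ‖η‖ * ‖F' η‖ₑ) ^ 2 < ⊤ := by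
    simpa using hsqF' 1
  have hgL2 : MemLp F' 2 volume := by
    refine ⟨hFm', ?_⟩
    rw [← lintegral_enorm_sq_rpow_half_eq_eLpNorm]
    refine ENNReal.rpow_lt_top_of_nonneg (by norm_num) (ne_of_lt ?_)
    simpa using hsqF' 0
  have hmain := eLpNorm_lconv_norm_weight_le hfm hFm' hf1 hf2 hfL2 hf2L2 hg0 hg1 hgL2 hg1L2
  set K3 : ℝ≥0∞ := (SNormLESNormFDerivOfEqConst ℂ (volume : Measure (EuclideanSpace ℝ (Fin 3))) 2 *
    ENNReal.ofReal (2 * π)) ^ (3 / 2 : ℝ) with hK3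
  set b := eLpNorm (fun η : EuclideanSpace ℝ (Fin 3) => ENNReal.ofReal (‖η‖ ^ 2) * ∑ j, ‖u η j‖ₑ) 2 volume
    with hb
  set e := eLpNorm (fun η : EuclideanSpace ℝ (Fin 3) => ENNReal.ofReal (‖η‖ ^ 3) * ∑ j, ‖u η j‖ₑ) 2 volume
    with he
  set a' := eLpNorm (fun η : EuclideanSpace ℝ (Fin 3) => ENNReal.ofReal ‖η‖ * ∑ j, ‖u' η j‖ₑ) 2 volume
    with ha'
  have e1 : eLpNorm (fun η : EuclideanSpace ℝ (Fin 3) => ENNReal.ofReal ‖η‖ * ‖f η‖ₑ) 2 volume = b := by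
    rw [hb]; congr 1; funext η; rw [hpow1 η]
  have e2 : eLpNorm (fun η : EuclideanSpace ℝ (Fin 3) => ENNReal.ofReal (‖η‖ ^ 2) * ‖f η‖ₑ) 2 volume = e := by
    rw [he]; congr 1; funext η; rw [hpow η 2]
  have e3 : eLpNorm (fun η : EuclideanSpace ℝ (Fin 3) => ENNReal.ofReal ‖η‖ * ‖F' η‖ₑ) 2 volume = a' := by
    simp_rw [hFe']; exact ha'.symm
  rw [e1, e2, e3] at hmain
  have hlhs : ∫⁻ ξ, (((fun η => ENNReal.ofReal (‖η‖ ^ 2) * ∑ j, ‖u η j‖ₑ) ⋆ₗ (fun η => ∑ j, ‖u' η j‖ₑ)) ξ) ^ 2 =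
      eLpNorm (fun ξ => ((fun η => ENNReal.ofReal ‖η‖ * ‖f η‖ₑ) ⋆ₗ (fun η => ‖F' η‖ₑ)) ξ) 2 volume ^ 2 := by
    rw [← lintegral_enorm_sq_eq_eLpNorm_sq]
    simp_rw [enorm_eq_self, hFe']
    refine lintegral_congr fun ξ => ?_
    congr 2
    funext η
    rw [hpow1 η]
  rw [hlhs]
  calc eLpNorm (fun ξ => ((fun η => ENNReal.ofReal ‖η‖ * ‖f η‖ₑ) ⋆ₗ (fun η => ‖F' η‖ₑ)) ξ) 2 volume ^ 2
      ≤ (K3 * b ^ (1 / 2 : ℝ) * e ^ (1 / 2 : ℝ) * a') ^ 2 := pow_le_pow_left' hmain 2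
    _ = K3 ^ 2 * (b * e * a' ^ 2) := by
        have hh : ∀ x : ℝ≥0∞, (x ^ (1 / 2 : ℝ)) ^ 2 = x := fun x => by
          rw [← ENNReal.rpow_natCast, ← ENNReal.rpow_mul]; norm_num
        rw [mul_pow, mul_pow, mul_pow, hh, hh]; ring

/-- **The level-two bound at a fixed time, symmetrised**:
`∫⁻ (ρ²‖(F ⋆ F')(ξ)‖ₑ)² ≤ 8K₃²(b e a'² + b' e' a²)`, `b = ‖ρ²F‖₂`, `e = ‖ρ³F‖₂`, `a = ‖ρF‖₂` and
primed quantities for `F'` (`ρ²(|F| ⋆ |F'|) ≤ 2((ρ²|F|) ⋆ |F'| + (ρ²|F'|) ⋆ |F|)`). Linear in the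
top-order quantities `b, e` of each factor — the structure that propagates the `X²` norm with a
coefficient of `X¹` size (Tao 2013, proof of Thm. 5.1: "the estimates for higher `k` follow from
variants of the above argument and an induction on `k`"). [cite: Tao2011, Lemma 2.1 (arXiv Lemma 23)] -/
theorem lintegral_norm_sq_mul_fconv_majorant_sq_le (hu : AEStronglyMeasurable u volume)
    (hu' : AEStronglyMeasurable u' volume)
    (h2 : ∀ j, MemLp (u · j) 2 volume) (h2' : ∀ j, MemLp (u' · j) 2 volume)
    (hw : ∀ (k : ℕ) j, ∫⁻ η, (ENNReal.ofReal ((1 + ‖η‖) ^ k) * ‖u η j‖ₑ) ^ 2 < ⊤)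
    (hw' : ∀ (k : ℕ) j, ∫⁻ η, (ENNReal.ofReal ((1 + ‖η‖) ^ k) * ‖u' η j‖ₑ) ^ 2 < ⊤) :
    ∫⁻ ξ, (ENNReal.ofReal (‖ξ‖ ^ 2) * ‖fconv (fun η => ((∑ j, ‖u η j‖ : ℝ) : ℂ))
        (fun η => ((∑ j, ‖u' η j‖ : ℝ) : ℂ)) ξ‖ₑ) ^ 2 ≤
      8 * ((SNormLESNormFDerivOfEqConst ℂ (volume : Measure (EuclideanSpace ℝ (Fin 3))) 2 *
          ENNReal.ofReal (2 * π)) ^ (3 / 2 : ℝ)) ^ 2 *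
        (eLpNorm (fun η : EuclideanSpace ℝ (Fin 3) => ENNReal.ofReal (‖η‖ ^ 2) * ∑ j, ‖u η j‖ₑ) 2 volume *
           eLpNorm (fun η : EuclideanSpace ℝ (Fin 3) => ENNReal.ofReal (‖η‖ ^ 3) * ∑ j, ‖u η j‖ₑ) 2 volume *
           eLpNorm (fun η : EuclideanSpace ℝ (Fin 3) => ENNReal.ofReal ‖η‖ * ∑ j, ‖u' η j‖ₑ) 2 volume ^ 2 +
         eLpNorm (fun η : EuclideanSpace ℝ (Fin 3) => ENNReal.ofReal (‖η‖ ^ 2) * ∑ j, ‖u' η j‖ₑ) 2 volume *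
           eLpNorm (fun η : EuclideanSpace ℝ (Fin 3) => ENNReal.ofReal (‖η‖ ^ 3) * ∑ j, ‖u' η j‖ₑ) 2 volume *
           eLpNorm (fun η : EuclideanSpace ℝ (Fin 3) => ENNReal.ofReal ‖η‖ * ∑ j, ‖u η j‖ₑ) 2 volume ^ 2) := by
  set P : EuclideanSpace ℝ (Fin 3) → ℝ≥0∞ := fun η => ∑ j, ‖u η j‖ₑ with hP
  set Q : EuclideanSpace ℝ (Fin 3) → ℝ≥0∞ := fun η => ∑ j, ‖u' η j‖ₑ with hQ
  have hPm : AEMeasurable P volume := aemeasurable_majorant hu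
  have hQm : AEMeasurable Q volume := aemeasurable_majorant hu'
  set X : EuclideanSpace ℝ (Fin 3) → ℝ≥0∞ :=
    fun ξ => ((fun η => ENNReal.ofReal (‖η‖ ^ 2) * P η) ⋆ₗ Q) ξ with hX
  set Y : EuclideanSpace ℝ (Fin 3) → ℝ≥0∞ :=
    fun ξ => ((fun η => ENNReal.ofReal (‖η‖ ^ 2) * Q η) ⋆ₗ P) ξ with hY
  have hpt : ∀ ξ, ENNReal.ofReal (‖ξ‖ ^ 2) * ‖fconv (fun η => ((∑ j, ‖u η j‖ : ℝ) : ℂ))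
      (fun η => ((∑ j, ‖u' η j‖ : ℝ) : ℂ)) ξ‖ₑ ≤ 2 * (X ξ + Y ξ) := by
    intro ξ
    rw [← lconv_majorant_eq_enorm_fconv hu hu' h2 h2' ξ]
    refine (norm_sq_mul_lconv_le hPm hQm ξ).trans (le_of_eq ?_)
    rw [hX, hY]
    simp only
    congr 2
    exact congrFun (lconvolution_comm (f := P) (g := fun η => ENNReal.ofReal (‖η‖ ^ 2) * Q η)) ξ
  set K3 : ℝ≥0∞ := (SNormLESNormFDerivOfEqConst ℂ (volume : Measure (EuclideanSpace ℝ (Fin 3))) 2 *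
    ENNReal.ofReal (2 * π)) ^ (3 / 2 : ℝ) with hK3
  set a := eLpNorm (fun η : EuclideanSpace ℝ (Fin 3) => ENNReal.ofReal ‖η‖ * ∑ j, ‖u η j‖ₑ) 2 volume
    with ha
  set b := eLpNorm (fun η : EuclideanSpace ℝ (Fin 3) => ENNReal.ofReal (‖η‖ ^ 2) * ∑ j, ‖u η j‖ₑ) 2 volume
    with hb
  set e := eLpNorm (fun η : EuclideanSpace ℝ (Fin 3) => ENNReal.ofReal (‖η‖ ^ 3) * ∑ j, ‖u η j‖ₑ) 2 volume
    with he
  set a' := eLpNorm (fun η : EuclideanSpace ℝ (Fin 3) => ENNReal.ofReal ‖η‖ * ∑ j, ‖u' η j‖ₑ) 2 volume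
    with ha'
  set b' := eLpNorm (fun η : EuclideanSpace ℝ (Fin 3) => ENNReal.ofReal (‖η‖ ^ 2) * ∑ j, ‖u' η j‖ₑ) 2 volume
    with hb'
  set e' := eLpNorm (fun η : EuclideanSpace ℝ (Fin 3) => ENNReal.ofReal (‖η‖ ^ 3) * ∑ j, ‖u' η j‖ₑ) 2 volume
    with he'
  have hX2 : ∫⁻ ξ, X ξ ^ 2 ≤ K3 ^ 2 * (b * e * a' ^ 2) := lintegral_lconv_norm_sq_majorant_sq_le hu hu' hw hw'
  have hY2 : ∫⁻ ξ, Y ξ ^ 2 ≤ K3 ^ 2 * (b' * e' * a ^ 2) := lintegral_lconv_norm_sq_majorant_sq_le hu' hu hw' hw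
  have hXm : AEMeasurable X volume :=
    aemeasurable_lconvolution (((ENNReal.continuous_ofReal.comp (continuous_norm.pow 2)).measurable
      ).aemeasurable.mul hPm) hQm
  calc ∫⁻ ξ, (ENNReal.ofReal (‖ξ‖ ^ 2) * ‖fconv (fun η => ((∑ j, ‖u η j‖ : ℝ) : ℂ))
        (fun η => ((∑ j, ‖u' η j‖ : ℝ) : ℂ)) ξ‖ₑ) ^ 2
      ≤ ∫⁻ ξ, (2 * (X ξ + Y ξ)) ^ 2 := lintegral_mono fun ξ => pow_le_pow_left' (hpt ξ) 2
    _ ≤ ∫⁻ ξ, (8 * X ξ ^ 2 + 8 * Y ξ ^ 2) := lintegral_mono fun ξ => by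
        have hsq : ∀ a b : ℝ≥0∞, (a + b) ^ 2 ≤ 2 * (a ^ 2 + b ^ 2) := fun a b => by
          have h := ENNReal.rpow_add_le_mul_rpow_add_rpow a b (p := 2) (by norm_num)
          norm_num at h
          exact_mod_cast h
        rw [mul_pow, ← mul_add]
        calc (2 : ℝ≥0∞) ^ 2 * (X ξ + Y ξ) ^ 2 ≤ 2 ^ 2 * (2 * (X ξ ^ 2 + Y ξ ^ 2)) := by
              gcongr; exact hsq _ _
          _ = 8 * (X ξ ^ 2 + Y ξ ^ 2) := by ring
    _ = 8 * (∫⁻ ξ, X ξ ^ 2) + 8 * (∫⁻ ξ, Y ξ ^ 2) := by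
        rw [lintegral_add_left' ((hXm.pow_const 2).const_mul 8)]
        congr 1 <;> exact lintegral_const_mul' _ _ (by norm_num)
    _ ≤ 8 * (K3 ^ 2 * (b * e * a' ^ 2)) + 8 * (K3 ^ 2 * (b' * e' * a ^ 2)) :=
        add_le_add (mul_le_mul' le_rfl hX2) (mul_le_mul' le_rfl hY2)
    _ = _ := by ring

end LevelTwo

end Literature.Analysis.FluidPDE.FourierNS

end
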